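import Mathlib.Analysis.InnerProductSpace.PiL2
import Mathlib.Data.Int.ModEq
import Mathlib.Data.Int.Interval
import Mathlib.Topology.Algebra.InfiniteSum.Basic
import Mathlib.Tactic
import Literature.MathematicalPhysics.StatisticalMechanics.HaggStacking
import Literature.MathematicalPhysics.StatisticalMechanics.BarlowStacking
import Literature.MathematicalPhysics.StatisticalMechanics.BarlowStackingEnergy
import HarnessLib

/-!
# The Shockley block flip of a Barlow stacking, layer by layer

Companion of `BarlowStacking.lean`, `BarlowStackingEnergy.lean` and `HaggStacking.lean`: the
generic lattice bookkeeping behind the restacking competitor of the crux `StackingFaultSparsity`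
(`stmt-AtomisticToContinuum-14296`). A Barlow stacking is coded by a Hägg word `s : ℤ → {±1}`
with layer labels `L = haggLabel s`; the **block flip** of `[q₁, q₂)` is the word
`s' n = if q₁ ≤ n ∧ n < q₂ then -s n else s n` — the Hägg word of the stacking obtained by
sliding the slab of layers `q₁ < n < q₂` rigidly in-plane by Shockley partials `± w`,
`w = barlowOffset a = (u + v)/3`, a legitimate restacking when the block carries zero registry
charge `3 ∣ L(q₂) - L(q₁)`. We record:

* `isHaggSeq_blockFlip` and the labels of the flipped word: below the block all labels move by
  the same amount `D = L'(q₁) - L(q₁)` (`haggLabel_blockFlip_of_le`), on the block the label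
  differences are negated (`haggLabel_blockFlip_of_mem`), above it they are unchanged
  (`haggLabel_blockFlip_of_ge`);
* `blockFlip_registry_modEq`: if the layers `q₁ < n < q₂` are shifted in-plane by `σ_n • w` with
  `σ_n ≡ L(n) - L(q₁) (mod 3)` and the other layers are not moved (`σ_n = 0`), then (zero charge)
  every layer `n` of the shifted stacking sits in the lateral position `L'(n) - D (mod 3)`: the
  shifted stacking is the stacking of the flipped word up to the global in-plane translation
  `-D • w` and in-layer lattice translations; `blockFlip_registry_sub_modEq` is the relative form;
* `tsum_layer_shift`: the interaction of the point `barlowPos a h s m i j + σ • w` with the full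
  shifted layer `{barlowPos a h s n i' j' + τ • w}` is
  `layerInteraction V a h (L n - L m + (τ - σ)) (n - m)` (any base point `(i, j)`; the layer sum
  only depends on the offset modulo `3`, `layerInteraction_congr_of_modEq`);
* `blockFlip_layer_tsum_sub`, `blockFlip_sum_layer_tsum_sub` (**the bulk identity**): for a site
  of layer `m` and the full layer `m + k`, the pair interaction after minus before the flip is
  `(1[aligned_{s'}(m,k)] - 1[aligned_s(m,k)]) · J_k`, `J = barlowCoupling V a h`, and summed over
  `1 ≤ k ≤ K` it is `haggLocalEnergyTrunc K J s' m - haggLocalEnergyTrunc K J s m`;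
* `norm_layerVec_eq_zero_or_le`, `le_dist_barlowPos_add_zsmul`: all the points
  `barlowPos a h s k i j + σ • w` (`σ ∈ ℤ`) lie on the refined lattice `(ℤu + ℤv + ℤw) ⊕ ℤ h e₃`,
  whose distinct points are `≥ min (a/√3) h` apart (`3(2i+j+δ)² + (3j+δ)² ∈ {0} ∪ [4, ∞)`), and
  `abs_sub_mul_le_dist_barlowPos_add_zsmul` (the vertical component bounds the distance below).

All elementary ([folklore]); the framing — Shockley partial `w`, growth/deformation faults as
flips of blocks of the Hägg word — is that of Pártay–Ortner–Bartók–Pickard–Csányi,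
*Polytypism in the ground state structure of the Lennard-Jonesium*, PCCP 19 (2017), Appendix A.
-/

noncomputable section

open Finset

namespace Literature.MathematicalPhysics.StatisticalMechanics

/-! ## The flipped word and its labels -/

section Word

variable {s s' : ℤ → ℤ} {q₁ q₂ : ℤ}

/-- The block flip of a `±1` word is a `±1` word. [folklore] -/
theorem isHaggSeq_blockFlip (hs : IsHaggSeq s)
    (hs' : ∀ n, s' n = if q₁ ≤ n ∧ n < q₂ then -s n else s n) : IsHaggSeq s' := by
  intro n
  rw [hs']
  split_ifs
  · rcases hs n with h | h <;> rw [h] <;> norm_num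
  · exact hs n

/-- Label differences are window sums: `L n - L m = s m + ⋯ + s (n - 1)` for `m ≤ n`.
[folklore] -/
theorem haggLabel_sub_eq_haggWindow (s : ℤ → ℤ) {m n : ℤ} (hmn : m ≤ n) :
    haggLabel s n - haggLabel s m = haggWindow s m (n - m).toNat := by
  have h1 := haggLabel_add_natCast s m (n - m).toNat
  rw [Int.toNat_of_nonneg (sub_nonneg.2 hmn), add_sub_cancel] at h1
  linarith

/-- **Below the block** the flip moves all labels by the same amount `L'(q₁) - L(q₁)`.
[folklore] -/
theorem haggLabel_blockFlip_of_le (hs' : ∀ n, s' n = if q₁ ≤ n ∧ n < q₂ then -s n else s n)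
    {n : ℤ} (hn : n ≤ q₁) :
    haggLabel s' n - haggLabel s n = haggLabel s' q₁ - haggLabel s q₁ := by
  have h1 := haggLabel_sub_eq_haggWindow s hn
  have h2 := haggLabel_sub_eq_haggWindow s' hn
  have hw : haggWindow s' n (q₁ - n).toNat = haggWindow s n (q₁ - n).toNat := by
    refine Finset.sum_congr rfl fun i hi => ?_
    rw [Finset.mem_range] at hi
    have hi' : (i : ℤ) < q₁ - n := by
      have : (i : ℤ) < ((q₁ - n).toNat : ℤ) := by exact_mod_cast hi
      rwa [Int.toNat_of_nonneg (by omega)] at this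
    rw [hs', if_neg (by omega)]
  linarith

/-- **On the block** the flip negates the label differences. [folklore] -/
theorem haggLabel_blockFlip_of_mem (hs' : ∀ n, s' n = if q₁ ≤ n ∧ n < q₂ then -s n else s n)
    {n : ℤ} (hn₁ : q₁ ≤ n) (hn₂ : n ≤ q₂) :
    haggLabel s' n - haggLabel s' q₁ = -(haggLabel s n - haggLabel s q₁) := by
  rw [haggLabel_sub_eq_haggWindow s hn₁, haggLabel_sub_eq_haggWindow s' hn₁, haggWindow,
    haggWindow, ← Finset.sum_neg_distrib]
  refine Finset.sum_congr rfl fun i hi => ?_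
  rw [Finset.mem_range] at hi
  have hi' : (i : ℤ) < n - q₁ := by
    have : (i : ℤ) < ((n - q₁).toNat : ℤ) := by exact_mod_cast hi
    rwa [Int.toNat_of_nonneg (by omega)] at this
  rw [hs', if_pos (by constructor <;> omega)]

/-- **Above the block** the label differences are unchanged. [folklore] -/
theorem haggLabel_blockFlip_of_ge (hs' : ∀ n, s' n = if q₁ ≤ n ∧ n < q₂ then -s n else s n)
    {n : ℤ} (hn : q₂ ≤ n) :
    haggLabel s' n - haggLabel s' q₂ = haggLabel s n - haggLabel s q₂ := by
  rw [haggLabel_sub_eq_haggWindow s hn, haggLabel_sub_eq_haggWindow s' hn]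
  refine Finset.sum_congr rfl fun i _ => ?_
  rw [hs', if_neg (by omega)]

/-- **The registry of the shifted slab.** Let the block `[q₁, q₂)` (`q₁ ≤ q₂`) carry zero
charge `3 ∣ L(q₂) - L(q₁)`, and let `σ : ℤ → ℤ` vanish off `(q₁, q₂)` and satisfy
`σ n ≡ L(n) - L(q₁) (mod 3)` on `(q₁, q₂)`. Then the shifted layer `n` (lateral letter
`L(n) + σ n`) sits at the letter `L'(n) - (L'(q₁) - L(q₁))` of the flipped word, for EVERY `n`:
below the block trivially, on the block since `-2 ≡ 1 (mod 3)`, above it by the zero charge.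
[folklore] -/
theorem blockFlip_registry_modEq (hq : q₁ ≤ q₂)
    (hs' : ∀ n, s' n = if q₁ ≤ n ∧ n < q₂ then -s n else s n)
    (hcharge : (3 : ℤ) ∣ haggLabel s q₂ - haggLabel s q₁) {σ : ℤ → ℤ}
    (hσ₁ : ∀ n, q₁ < n → n < q₂ → σ n ≡ haggLabel s n - haggLabel s q₁ [ZMOD 3])
    (hσ₀ : ∀ n, n ≤ q₁ ∨ q₂ ≤ n → σ n = 0) (n : ℤ) :
    haggLabel s n + σ n ≡ haggLabel s' n - (haggLabel s' q₁ - haggLabel s q₁) [ZMOD 3] := by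
  rcases le_or_gt n q₁ with hn | hn
  · rw [hσ₀ n (Or.inl hn), add_zero, Int.modEq_iff_dvd]
    have h1 := haggLabel_blockFlip_of_le hs' hn
    exact ⟨0, by linarith⟩
  · rcases lt_or_ge n q₂ with hn' | hn'
    · have h1 := haggLabel_blockFlip_of_mem hs' hn.le hn'.le
      have h2 := hσ₁ n hn hn'
      rw [Int.modEq_iff_dvd] at h2 ⊢
      have h3 : haggLabel s' n - (haggLabel s' q₁ - haggLabel s q₁) - (haggLabel s n + σ n) =
          3 * (-(haggLabel s n - haggLabel s q₁)) + (haggLabel s n - haggLabel s q₁ - σ n) := by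
        linarith
      rw [h3]
      exact dvd_add (dvd_mul_right 3 _) h2
    · rw [hσ₀ n (Or.inr hn'), add_zero, Int.modEq_iff_dvd]
      have h1 := haggLabel_blockFlip_of_ge hs' hn'
      have h2 := haggLabel_blockFlip_of_mem hs' hq le_rfl
      have h3 : haggLabel s' n - (haggLabel s' q₁ - haggLabel s q₁) - haggLabel s n =
          -2 * (haggLabel s q₂ - haggLabel s q₁) := by linarith
      rw [h3]
      exact hcharge.mul_left _

/-- Relative form of `blockFlip_registry_modEq`: the relative letter of the shifted layers
`m`, `n` is the relative letter of the flipped word. [folklore] -/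
theorem blockFlip_registry_sub_modEq (hq : q₁ ≤ q₂)
    (hs' : ∀ n, s' n = if q₁ ≤ n ∧ n < q₂ then -s n else s n)
    (hcharge : (3 : ℤ) ∣ haggLabel s q₂ - haggLabel s q₁) {σ : ℤ → ℤ}
    (hσ₁ : ∀ n, q₁ < n → n < q₂ → σ n ≡ haggLabel s n - haggLabel s q₁ [ZMOD 3])
    (hσ₀ : ∀ n, n ≤ q₁ ∨ q₂ ≤ n → σ n = 0) (m n : ℤ) :
    haggLabel s n + σ n - (haggLabel s m + σ m) ≡ haggLabel s' n - haggLabel s' m [ZMOD 3] := by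
  have h := (blockFlip_registry_modEq hq hs' hcharge hσ₁ hσ₀ n).sub
    (blockFlip_registry_modEq hq hs' hcharge hσ₁ hσ₀ m)
  rwa [sub_sub_sub_cancel_right] at h

end Word

/-! ## Layer sums seen from a shifted site -/

section Layers

variable (V : ℝ → ℝ) (a h : ℝ)

/-- `layerInteraction` only depends on the offset modulo `3`. [folklore] -/
theorem layerInteraction_congr_of_modEq {δ δ' : ℤ} (hδ : δ ≡ δ' [ZMOD 3]) (k : ℤ) :
    layerInteraction V a h δ k = layerInteraction V a h δ' k := by
  obtain ⟨c, hc⟩ := Int.modEq_iff_dvd.1 hδ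
  rw [show δ' = δ + 3 * c by linarith, layerInteraction_add_three_mul]

/-- Differences of shifted stacking points are `layerVec`s. [folklore] -/
theorem barlowPos_add_sub_barlowPos_add (s : ℤ → ℤ) (m i j n i' j' σ τ : ℤ) :
    barlowPos a h s n i' j' + (τ : ℝ) • barlowOffset a -
        (barlowPos a h s m i j + (σ : ℝ) • barlowOffset a) =
      layerVec a h (haggLabel s n - haggLabel s m + (τ - σ)) (n - m) (i' - i) (j' - j) := by
  simp only [barlowPos, layerVec, Int.cast_sub, Int.cast_add]
  module

/-- **Interaction of a shifted site with a shifted full layer**: seen from the point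
`barlowPos a h s m i j + σ • w`, the layer `{barlowPos a h s n i' j' + τ • w : i', j' ∈ ℤ}`
contributes the lattice sum `layerInteraction V a h (L n - L m + (τ - σ)) (n - m)` (reindexing
`(i', j') ↦ (i' - i, j' - j)`; no summability needed). [folklore] -/
theorem tsum_layer_shift (s : ℤ → ℤ) (m i j n σ τ : ℤ) :
    ∑' ij : ℤ × ℤ, V (dist (barlowPos a h s m i j + (σ : ℝ) • barlowOffset a)
        (barlowPos a h s n ij.1 ij.2 + (τ : ℝ) • barlowOffset a)) =
      layerInteraction V a h (haggLabel s n - haggLabel s m + (τ - σ)) (n - m) := by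
  unfold layerInteraction
  rw [← Equiv.tsum_eq (Equiv.subRight ((i, j) : ℤ × ℤ)) fun ij : ℤ × ℤ =>
    V ‖layerVec a h (haggLabel s n - haggLabel s m + (τ - σ)) (n - m) ij.1 ij.2‖]
  refine tsum_congr fun ij => ?_
  rw [dist_comm, dist_eq_norm, barlowPos_add_sub_barlowPos_add]
  simp only [Equiv.subRight_apply, Prod.fst_sub, Prod.snd_sub]

/-- Interaction of the site `barlowPos a h s m i j` with the full layer `n`:
`layerInteraction V a h (L n - L m) (n - m)` (`tsum_layer` from a general site). [folklore] -/
theorem tsum_layer_site (s : ℤ → ℤ) (m i j n : ℤ) :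
    ∑' ij : ℤ × ℤ, V (dist (barlowPos a h s m i j) (barlowPos a h s n ij.1 ij.2)) =
      layerInteraction V a h (haggLabel s n - haggLabel s m) (n - m) := by
  have h0 := tsum_layer_shift V a h s m i j n 0 0
  simp only [Int.cast_zero, zero_smul, add_zero, sub_self] at h0
  exact h0

/-- The layer interaction at the label offset of a word is `Φ_N(k) + J_k · 1[aligned(m, k)]`.
[folklore] -/
theorem layerInteraction_haggLabel_sub (s : ℤ → ℤ) (m : ℤ) (k : ℕ) :
    layerInteraction V a h (haggLabel s (m + k) - haggLabel s m) k =
      layerInteraction V a h 1 k + if HaggAligned s m k then barlowCoupling V a h k else 0 := by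
  rw [haggLabel_add_natCast, add_sub_cancel_left, layerInteraction_eq_ite,
    ite_layerInteraction_eq]

/-- **The pair interaction of a site with a full layer, after minus before the block flip.**
With the slab shifts `σ` of `blockFlip_registry_modEq` (zero-charge block `[q₁, q₂)`), for a site
of layer `m` (shifted by `σ m • w`) and the full layer `m + k` (shifted by `σ (m + k) • w`) the
interaction after the flip minus the interaction before it is
`(1[aligned_{s'}(m, k)] - 1[aligned_s(m, k)]) · J_k`, `J = barlowCoupling V a h`
(`tsum_layer_shift`, `layerInteraction_eq_ite`). [folklore] -/
theorem blockFlip_layer_tsum_sub {s s' : ℤ → ℤ} {q₁ q₂ : ℤ} (hq : q₁ ≤ q₂)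
    (hs' : ∀ n, s' n = if q₁ ≤ n ∧ n < q₂ then -s n else s n)
    (hcharge : (3 : ℤ) ∣ haggLabel s q₂ - haggLabel s q₁) {σ : ℤ → ℤ}
    (hσ₁ : ∀ n, q₁ < n → n < q₂ → σ n ≡ haggLabel s n - haggLabel s q₁ [ZMOD 3])
    (hσ₀ : ∀ n, n ≤ q₁ ∨ q₂ ≤ n → σ n = 0) (m i j : ℤ) (k : ℕ) :
    (∑' ij : ℤ × ℤ, V (dist (barlowPos a h s m i j + ((σ m : ℤ) : ℝ) • barlowOffset a)
        (barlowPos a h s (m + k) ij.1 ij.2 + ((σ (m + k) : ℤ) : ℝ) • barlowOffset a))) -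
      ∑' ij : ℤ × ℤ, V (dist (barlowPos a h s m i j) (barlowPos a h s (m + k) ij.1 ij.2)) =
      (if HaggAligned s' m k then barlowCoupling V a h k else 0) -
        (if HaggAligned s m k then barlowCoupling V a h k else 0) := by
  rw [tsum_layer_shift, tsum_layer_site, add_sub_cancel_left]
  have hmod : haggLabel s (m + k) - haggLabel s m + (σ (m + k) - σ m) ≡
      haggLabel s' (m + k) - haggLabel s' m [ZMOD 3] := by
    have h1 := blockFlip_registry_sub_modEq hq hs' hcharge hσ₁ hσ₀ m (m + k)
    have h2 : haggLabel s (m + k) - haggLabel s m + (σ (m + k) - σ m) =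
        haggLabel s (m + ↑k) + σ (m + ↑k) - (haggLabel s m + σ m) := by ring
    rw [h2]
    exact h1
  rw [layerInteraction_congr_of_modEq V a h hmod, layerInteraction_haggLabel_sub,
    layerInteraction_haggLabel_sub]
  ring

/-- Over `1 ≤ k ≤ K` the alignment indicators sum to the truncated local energy (the adjacent
layer `k = 1` is never aligned for a `±1` word). [folklore] -/
theorem sum_Icc_one_ite_haggAligned {s : ℤ → ℤ} (hs : IsHaggSeq s) (K : ℕ) (J : ℕ → ℝ)
    (m : ℤ) :
    ∑ k ∈ Icc 1 K, (if HaggAligned s m k then J k else 0) = haggLocalEnergyTrunc K J s m := by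
  unfold haggLocalEnergyTrunc
  rcases Nat.eq_zero_or_pos K with rfl | hK
  · simp
  · have hI : Icc 1 K = insert 1 (Icc 2 K) := by
      ext k
      simp only [mem_Icc, mem_insert]
      omega
    rw [hI, Finset.sum_insert (by simp), if_neg (not_haggAligned_one hs m), zero_add]

/-- **The bulk identity of the block flip, per site**: summed over the full layers `m + k`,
`1 ≤ k ≤ K`, the interaction of a (shifted) site of layer `m` after minus before the flip is
`haggLocalEnergyTrunc K J s' m - haggLocalEnergyTrunc K J s m`, `J = barlowCoupling V a h`:
each pair of layers is counted once, from its lower layer, so no backward local energies occur.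
[folklore] -/
theorem blockFlip_sum_layer_tsum_sub {s s' : ℤ → ℤ} {q₁ q₂ : ℤ} (hs : IsHaggSeq s)
    (hq : q₁ ≤ q₂) (hs' : ∀ n, s' n = if q₁ ≤ n ∧ n < q₂ then -s n else s n)
    (hcharge : (3 : ℤ) ∣ haggLabel s q₂ - haggLabel s q₁) {σ : ℤ → ℤ}
    (hσ₁ : ∀ n, q₁ < n → n < q₂ → σ n ≡ haggLabel s n - haggLabel s q₁ [ZMOD 3])
    (hσ₀ : ∀ n, n ≤ q₁ ∨ q₂ ≤ n → σ n = 0) (K : ℕ) (m i j : ℤ) :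
    ∑ k ∈ Icc 1 K,
      ((∑' ij : ℤ × ℤ, V (dist (barlowPos a h s m i j + ((σ m : ℤ) : ℝ) • barlowOffset a)
          (barlowPos a h s (m + k) ij.1 ij.2 + ((σ (m + k) : ℤ) : ℝ) • barlowOffset a))) -
        ∑' ij : ℤ × ℤ, V (dist (barlowPos a h s m i j) (barlowPos a h s (m + k) ij.1 ij.2))) =
      haggLocalEnergyTrunc K (barlowCoupling V a h) s' m -
        haggLocalEnergyTrunc K (barlowCoupling V a h) s m := by
  rw [Finset.sum_congr rfl fun k _ => blockFlip_layer_tsum_sub V a h hq hs' hcharge hσ₁ hσ₀ m i j k,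
    Finset.sum_sub_distrib, sum_Icc_one_ite_haggAligned (isHaggSeq_blockFlip hs hs'),
    sum_Icc_one_ite_haggAligned hs]

end Layers

/-! ## The refined lattice `ℤu + ℤv + ℤw` -/

section Refined

variable (a h : ℝ)

/-- In-plane vectors of the refined lattice in coordinates:
`‖i u + j v + δ w‖² = (a²/12) (3 (2i + j + δ)² + (3j + δ)²)`. [folklore] -/
theorem norm_layerVec_inplane_sq (δ i j : ℤ) :
    ‖layerVec a h δ 0 i j‖ ^ 2 =
      a ^ 2 / 12 * (3 * (2 * (i : ℝ) + j + δ) ^ 2 + (3 * (j : ℝ) + δ) ^ 2) := by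
  rw [norm_layerVec, Real.sq_sqrt (by positivity)]
  have h3 : (√3 : ℝ) ^ 2 = 3 := Real.sq_sqrt (by norm_num)
  push_cast
  linear_combination (a ^ 2 / 4 * ((j : ℝ) + δ / 3) ^ 2) * h3

/-- The integer form `3A² + B²`, `A = 2i + j + δ`, `B = 3j + δ`, vanishes or is `≥ 4`
(`A` and `B - A = 2(j - i)` have the same parity). [folklore] -/
theorem three_sq_add_sq_dichotomy (i j δ : ℤ) :
    (2 * i + j + δ = 0 ∧ 3 * j + δ = 0) ∨ 4 ≤ 3 * (2 * i + j + δ) ^ 2 + (3 * j + δ) ^ 2 := by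
  by_cases hA : 2 * i + j + δ = 0
  · by_cases hB : 3 * j + δ = 0
    · exact Or.inl ⟨hA, hB⟩
    · right
      rcases (show 3 * j + δ ≤ -2 ∨ 2 ≤ 3 * j + δ by omega) with h1 | h1 <;> nlinarith
  · right
    by_cases hB : 3 * j + δ = 0
    · rcases (show 2 * i + j + δ ≤ -2 ∨ 2 ≤ 2 * i + j + δ by omega) with h1 | h1 <;> nlinarith
    · have h1 : 1 ≤ (2 * i + j + δ) ^ 2 := by
        rcases (show 2 * i + j + δ ≤ -1 ∨ 1 ≤ 2 * i + j + δ by omega) with h | h <;> nlinarith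
      have h2 : 1 ≤ (3 * j + δ) ^ 2 := by
        rcases (show 3 * j + δ ≤ -1 ∨ 1 ≤ 3 * j + δ by omega) with h | h <;> nlinarith
      nlinarith

/-- **Uniform discreteness of the refined lattice**: a vector `i u + j v + δ w + k h e₃` of
`(ℤu + ℤv + ℤw) ⊕ ℤ h e₃` is `0` or has norm `≥ min (a/√3) h` (`0 ≤ a`; `a/√3 = ‖w‖`).
[folklore] -/
theorem norm_layerVec_eq_zero_or_le (ha : 0 ≤ a) (δ k i j : ℤ) :
    layerVec a h δ k i j = 0 ∨ min (a / √3) h ≤ ‖layerVec a h δ k i j‖ := by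
  by_cases hk : k = 0
  · subst hk
    have hsq := norm_layerVec_inplane_sq a h δ i j
    rcases three_sq_add_sq_dichotomy i j δ with ⟨hA, hB⟩ | h4
    · left
      have hA' : 2 * (i : ℝ) + j + δ = 0 := by exact_mod_cast hA
      have hB' : 3 * (j : ℝ) + δ = 0 := by exact_mod_cast hB
      have h0 : ‖layerVec a h δ 0 i j‖ ^ 2 = 0 := by rw [hsq, hA', hB']; ring
      exact norm_eq_zero.1 (pow_eq_zero_iff two_ne_zero |>.1 h0)
    · right
      refine (min_le_left _ _).trans ?_
      have h4' : (4 : ℝ) ≤ 3 * (2 * (i : ℝ) + j + δ) ^ 2 + (3 * (j : ℝ) + δ) ^ 2 := by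
        exact_mod_cast h4
      refine (pow_le_pow_iff_left₀ (by positivity) (norm_nonneg _) two_ne_zero).1 ?_
      rw [hsq, div_pow, Real.sq_sqrt (by norm_num : (0 : ℝ) ≤ 3)]
      nlinarith [sq_nonneg a]
  · right
    refine (min_le_right _ _).trans ?_
    rw [norm_layerVec]
    apply Real.le_sqrt_of_sq_le
    have hk1 : (1 : ℝ) ≤ (k : ℝ) ^ 2 := by
      have h1 : (1 : ℤ) ≤ |k| := Int.one_le_abs hk
      have h2 : (1 : ℤ) ≤ k ^ 2 := by nlinarith [sq_abs k]
      exact_mod_cast h2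
    nlinarith [sq_nonneg (a * ((i : ℝ) + j / 2 + δ / 2)),
      sq_nonneg (a * √3 / 2 * ((j : ℝ) + δ / 3)), sq_nonneg h,
      mul_nonneg (sub_nonneg.2 hk1) (sq_nonneg h)]

/-- **Shifted stacking points are uniformly discrete**: two points `barlowPos a h s k i j + σ • w`
(`σ ∈ ℤ`; all of them lie on the refined lattice) are equal or at distance `≥ min (a/√3) h`
(`0 ≤ a`). [folklore] -/
theorem le_dist_barlowPos_add_zsmul (s : ℤ → ℤ) (ha : 0 ≤ a) (k i j σ k' i' j' σ' : ℤ)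
    (hne : barlowPos a h s k i j + (σ : ℝ) • barlowOffset a ≠
      barlowPos a h s k' i' j' + (σ' : ℝ) • barlowOffset a) :
    min (a / √3) h ≤ dist (barlowPos a h s k i j + (σ : ℝ) • barlowOffset a)
      (barlowPos a h s k' i' j' + (σ' : ℝ) • barlowOffset a) := by
  rw [dist_comm, dist_eq_norm, barlowPos_add_sub_barlowPos_add]
  rcases norm_layerVec_eq_zero_or_le a h ha (haggLabel s k' - haggLabel s k + (σ' - σ))
    (k' - k) (i' - i) (j' - j) with h0 | hle
  · exfalso
    apply hne
    have h1 := barlowPos_add_sub_barlowPos_add a h s k i j k' i' j' σ σ'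
    rw [h0] at h1
    exact (sub_eq_zero.1 h1).symm
  · exact hle

/-- Third coordinate of a shifted stacking point: `k h` (the shift `w` is horizontal).
[folklore] -/
@[simp] theorem barlowPos_add_zsmul_apply_two (s : ℤ → ℤ) (k i j σ : ℤ) :
    (barlowPos a h s k i j + (σ : ℝ) • barlowOffset a) 2 = k * h := by
  simp [barlowOffset]

/-- First coordinate of a shifted stacking point. [folklore] -/
@[simp] theorem barlowPos_add_zsmul_apply_zero (s : ℤ → ℤ) (k i j σ : ℤ) :
    (barlowPos a h s k i j + (σ : ℝ) • barlowOffset a) 0 =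
      a * (i + j / 2 + (haggLabel s k + σ) / 2) := by
  simp [barlowOffset]
  ring

/-- Second coordinate of a shifted stacking point. [folklore] -/
@[simp] theorem barlowPos_add_zsmul_apply_one (s : ℤ → ℤ) (k i j σ : ℤ) :
    (barlowPos a h s k i j + (σ : ℝ) • barlowOffset a) 1 =
      a * √3 / 2 * (j + (haggLabel s k + σ) / 3) := by
  simp [barlowOffset]
  ring

/-- **The vertical component bounds the distance below**: shifted points of layers `k`, `k'`
are at distance `≥ |k - k'| h`. [folklore] -/
theorem abs_sub_mul_le_dist_barlowPos_add_zsmul (s : ℤ → ℤ) (k i j σ k' i' j' σ' : ℤ) :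
    |((k : ℝ) - k') * h| ≤ dist (barlowPos a h s k i j + (σ : ℝ) • barlowOffset a)
      (barlowPos a h s k' i' j' + (σ' : ℝ) • barlowOffset a) := by
  refine le_trans (le_of_eq ?_) (PiLp.dist_apply_le (barlowPos a h s k i j + (σ : ℝ) • barlowOffset a)
    (barlowPos a h s k' i' j' + (σ' : ℝ) • barlowOffset a) 2)
  rw [barlowPos_add_zsmul_apply_two, barlowPos_add_zsmul_apply_two, Real.dist_eq, sub_mul]

/-- **Squared distance of shifted stacking points = squared lateral distance + (vertical)²**,
the lateral part in the first two coordinates. [folklore] -/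
theorem dist_barlowPos_add_zsmul_sq (s : ℤ → ℤ) (k i j σ k' i' j' σ' : ℤ) :
    dist (barlowPos a h s k i j + (σ : ℝ) • barlowOffset a)
        (barlowPos a h s k' i' j' + (σ' : ℝ) • barlowOffset a) ^ 2 =
      ((barlowPos a h s k i j + (σ : ℝ) • barlowOffset a) 0 -
          (barlowPos a h s k' i' j' + (σ' : ℝ) • barlowOffset a) 0) ^ 2 +
        ((barlowPos a h s k i j + (σ : ℝ) • barlowOffset a) 1 -
          (barlowPos a h s k' i' j' + (σ' : ℝ) • barlowOffset a) 1) ^ 2 +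
        (((k : ℝ) - k') * h) ^ 2 := by
  rw [EuclideanSpace.dist_sq_eq, Fin.sum_univ_three, Real.dist_eq, Real.dist_eq, Real.dist_eq,
    sq_abs, sq_abs, sq_abs, barlowPos_add_zsmul_apply_two, barlowPos_add_zsmul_apply_two, sub_mul]

end Refined

end Literature.MathematicalPhysics.StatisticalMechanics

end
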